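import Summits.Ventures.LatticeQCDFlow.Scoring.BesselIRatioWeakCoupling
import Literature.Analysis.FunctionSpaces.BesselIIntegralSeries
import HarnessLib

/-!
# Continuum-limit scaling of Bessel-ratio powers: `(I_{a+n}(β)/I_a(β))^V → e^{−v n(2a+n)/2}` when `V/β → v`

HONEST FRAMING: exact (Metropolis-corrected) sampling algorithms for lattice gauge theory;
figures of merit are autocorrelation/cost numbers at stated couplings and volumes; no
continuum-physics claim.

Venture `LatticeQCDFlow` (cell pub-lqcd), sub-topic `Scoring`; FANOUT row 5 (`s0-sun-a`), GEN-15.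
NEW WORK of the cell (placement rule).  The exact 2-d partition functions of the tree are sums of
`V`-th powers of Bessel ratios (`V = L²` plaquettes): `Z^{U(1)} = (e^{−β} I₀(β))^V Σ_{n∈ℤ} (I_{|n|}(β)/I₀(β))^V`
(`Scoring/U1TorusPartitionFunctionBessel.lean`) and
`Z^{SU(2)} = (e^{−2β} I₁(2β)/β)^V Σ_{n∈ℕ} (I_{n+1}(2β)/I₁(2β))^V` (`Scoring/SU2TorusPartitionFunction.lean`).
Their continuum limit (`β → ∞`, `V → ∞`, `V/β → v` = the area in units of the coupling) is governed
by the two lemmas of this file: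

* **`tendsto_mul_log_besselI_div_succ`** — `x log(I_m(x)/I_{m+1}(x)) → m + ½`
  (`Scoring/BesselIRatioWeakCoupling.lean` and `1 − r ≤ log(1/r) ≤ (1 − r)/r`), telescoped to
  **`tendsto_mul_log_besselI_div`** — `x log(I_a(x)/I_{a+n}(x)) → n(2a+n)/2` (`= n²/2` for `a = 0`:
  the `U(1)` Casimir; `= n(n+2)/2` for `a = 1`: with `x = 2β`, the `SU(2)` Casimir `n(n+2)/4 = s(s+1)`,
  `s = n/2`);
* **`tendsto_besselI_ratio_pow`** — along any sequence `β_j → ∞`, `V_j/β_j → v`: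
  `(I_{a+n}(β_j)/I_a(β_j))^{V_j} → exp(−v n(2a+n)/2)`;
* **domination** for the dominated-convergence step (from the tree's Amos-type Gaussian bounds
  `e^{−n(n+1)/(2x)} ≤ I_n/I₀ ≤ e^{−n(n−1)/(2(x+n))}`): `besselI_ratio_zero_pow_le` —
  `(I_m(x)/I₀(x))^V ≤ e^{c} e^{−c m}`, `c = min(c₁/4, ½)`, whenever `c₁ x ≤ V`, `2 ≤ V`; and
  `besselI_ratio_one_pow_le` — `(I_{n+1}(x)/I₁(x))^V ≤ e^{c₂} e^{−c n}` whenever moreover `V ≤ c₂ x`.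

The limits of the partition functions themselves are `Scoring/TorusPartitionFunctionContinuumLimit.lean`.
Elementary given the parents; nothing is cited.  No sampler values.
-/

noncomputable section

open Real Filter Topology Set
open Literature.Analysis.FunctionSpaces

namespace Summit.Ventures.LatticeQCDFlow.Scoring

/-! ### 1. Logarithmic form of the weak-coupling law -/

/-- `I_{m+1}(x)/I_m(x) → 1` as `x → ∞`. -/
theorem tendsto_besselI_succ_div :
    ∀ m : ℕ, Tendsto (fun x : ℝ => besselI (m + 1) x / besselI m x) atTop (𝓝 1) := fun m => by
  have h0 : Tendsto (fun x : ℝ => x * (1 - besselI (m + 1) x / besselI m x) * x⁻¹) atTop (𝓝 0) := by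
    simpa using (tendsto_mul_one_sub_besselI_succ_div m).mul tendsto_inv_atTop_zero
  have h1 : Tendsto (fun x : ℝ => 1 - besselI (m + 1) x / besselI m x) atTop (𝓝 0) := by
    refine h0.congr' ?_
    filter_upwards [eventually_gt_atTop (0 : ℝ)] with x hx
    field_simp
  simpa using (tendsto_const_nhds (x := (1 : ℝ))).sub h1

/-- **`x log(I_m(x)/I_{m+1}(x)) → m + ½`** as `x → ∞` (`1 − r ≤ log(1/r) ≤ (1 − r)/r` with
`r = I_{m+1}/I_m → 1` and `x(1 − r) → m + ½`). -/
theorem tendsto_mul_log_besselI_div_succ (m : ℕ) :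
    Tendsto (fun x : ℝ => x * Real.log (besselI m x / besselI (m + 1) x)) atTop (𝓝 (m + 1 / 2)) := by
  have hT := tendsto_mul_one_sub_besselI_succ_div m
  have hr := tendsto_besselI_succ_div m
  have hup : Tendsto (fun x : ℝ => x * (1 - besselI (m + 1) x / besselI m x) /
      (besselI (m + 1) x / besselI m x)) atTop (𝓝 (m + 1 / 2)) := by
    have h := hT.div hr one_ne_zero
    rw [div_one] at h
    exact h
  refine tendsto_of_tendsto_of_tendsto_of_le_of_le' hT hup ?_ ?_
  · filter_upwards [eventually_gt_atTop (0 : ℝ)] with x hx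
    have h0 : 0 < besselI m x := besselI_pos m hx
    have h1 : 0 < besselI (m + 1) x := besselI_pos (m + 1) hx
    have hq : 0 < besselI m x / besselI (m + 1) x := div_pos h0 h1
    have hlog := Real.one_sub_inv_le_log_of_pos hq
    rw [inv_div] at hlog
    exact mul_le_mul_of_nonneg_left hlog hx.le
  · filter_upwards [eventually_gt_atTop (0 : ℝ)] with x hx
    have h0 : 0 < besselI m x := besselI_pos m hx
    have h1 : 0 < besselI (m + 1) x := besselI_pos (m + 1) hx
    have hq : 0 < besselI m x / besselI (m + 1) x := div_pos h0 h1
    have hlog := Real.log_le_sub_one_of_pos hq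
    have e : x * (1 - besselI (m + 1) x / besselI m x) / (besselI (m + 1) x / besselI m x) =
        x * (besselI m x / besselI (m + 1) x - 1) := by
      field_simp
    rw [e]
    exact mul_le_mul_of_nonneg_left hlog hx.le

/-- **`x log(I_a(x)/I_{a+n}(x)) → n(2a+n)/2`** as `x → ∞` (telescoping the previous lemma:
`Σ_{m=a}^{a+n−1} (m + ½) = n(2a+n)/2`). -/
theorem tendsto_mul_log_besselI_div (a : ℕ) :
    ∀ n : ℕ, Tendsto (fun x : ℝ => x * Real.log (besselI a x / besselI (a + n) x)) atTop
      (𝓝 ((n : ℝ) * (2 * a + n) / 2)) := by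
  intro n
  induction n with
  | zero =>
    have h : (fun _ : ℝ => (0 : ℝ)) =ᶠ[atTop] fun x : ℝ => x * Real.log (besselI a x / besselI (a + 0) x) := by
      filter_upwards [eventually_gt_atTop (0 : ℝ)] with x hx
      rw [add_zero, div_self (besselI_pos a hx).ne', Real.log_one, mul_zero]
    rw [show ((0 : ℕ) : ℝ) * (2 * a + ((0 : ℕ) : ℝ)) / 2 = 0 by simp]
    exact tendsto_const_nhds.congr' h
  | succ n ih =>
    have hstep := tendsto_mul_log_besselI_div_succ (a + n)
    have hsum := ih.add hstep
    have e : (n : ℝ) * (2 * a + n) / 2 + (((a + n : ℕ) : ℝ) + 1 / 2) =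
        ((n + 1 : ℕ) : ℝ) * (2 * a + ((n + 1 : ℕ) : ℝ)) / 2 := by
      push_cast; ring
    rw [e] at hsum
    refine hsum.congr' ?_
    filter_upwards [eventually_gt_atTop (0 : ℝ)] with x hx
    have h0 : 0 < besselI a x := besselI_pos a hx
    have h1 : 0 < besselI (a + n) x := besselI_pos (a + n) hx
    have h2 : 0 < besselI (a + n + 1) x := besselI_pos (a + n + 1) hx
    rw [← mul_add, ← Real.log_mul (div_pos h0 h1).ne' (div_pos h1 h2).ne', show a + (n + 1) = a + n + 1 by ring]
    congr 2
    field_simp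

/-! ### 2. Powers along a continuum-limit sequence -/

/-- **`(I_{a+n}(β_j)/I_a(β_j))^{V_j} → exp(−v n(2a+n)/2)`** whenever `β_j → ∞` and `V_j/β_j → v`. -/
theorem tendsto_besselI_ratio_pow {β : ℕ → ℝ} {V : ℕ → ℕ} {v : ℝ} (hβ : Tendsto β atTop atTop)
    (hv : Tendsto (fun j => (V j : ℝ) / β j) atTop (𝓝 v)) (a n : ℕ) :
    Tendsto (fun j => (besselI (a + n) (β j) / besselI a (β j)) ^ V j) atTop
      (𝓝 (Real.exp (-(v * ((n : ℝ) * (2 * a + n) / 2))))) := by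
  have h1 : Tendsto (fun j => (V j : ℝ) / β j * (β j * Real.log (besselI a (β j) / besselI (a + n) (β j))))
      atTop (𝓝 (v * ((n : ℝ) * (2 * a + n) / 2))) :=
    hv.mul ((tendsto_mul_log_besselI_div a n).comp hβ)
  have h2 := (Real.continuous_exp.tendsto _).comp h1.neg
  refine h2.congr' ?_
  filter_upwards [hβ.eventually_gt_atTop 0] with j hj
  have h0 : 0 < besselI a (β j) := besselI_pos a hj
  have hn : 0 < besselI (a + n) (β j) := besselI_pos (a + n) hj
  have hρ : 0 < besselI (a + n) (β j) / besselI a (β j) := div_pos hn h0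
  simp only [Function.comp_def]
  rw [show -((V j : ℝ) / β j * (β j * Real.log (besselI a (β j) / besselI (a + n) (β j)))) =
      (V j : ℝ) * Real.log (besselI (a + n) (β j) / besselI a (β j)) by
    rw [← inv_div (besselI (a + n) (β j)), Real.log_inv]; field_simp,
    Real.exp_nat_mul, Real.exp_log hρ]

/-! ### 3. Domination -/

/-- **Geometric domination of the `U(1)` terms**: for `x > 0`, `c₁ > 0`, `c₁ x ≤ V`, `2 ≤ V` and
every `m`, `(I_m(x)/I₀(x))^V ≤ e^{c} e^{−c m}` with `c = min(c₁/4, ½)` (Amos' Gaussian upper bound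
`I_m/I₀ ≤ e^{−m(m−1)/(2(x+m))}`, the cases `m ≤ x` and `m > x`). -/
theorem besselI_ratio_zero_pow_le {x c₁ : ℝ} (hx : 0 < x) (hc₁ : 0 < c₁) {V : ℕ} (hV : c₁ * x ≤ V)
    (hV2 : 2 ≤ V) (m : ℕ) :
    (besselI m x / besselI 0 x) ^ V ≤
      Real.exp (min (c₁ / 4) (1 / 2)) * Real.exp (-(min (c₁ / 4) (1 / 2) * m)) := by
  set c := min (c₁ / 4) (1 / 2) with hc
  have hc0 : 0 ≤ c := le_min (by positivity) (by norm_num)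
  have hI0 : 0 < besselI 0 x := besselI_pos 0 hx
  have hr0 : 0 ≤ besselI m x / besselI 0 x := div_nonneg (besselI_pos m hx).le hI0.le
  rcases Nat.eq_zero_or_pos m with rfl | hm
  · rw [div_self hI0.ne', one_pow, Nat.cast_zero, mul_zero, neg_zero, Real.exp_zero, mul_one]
    exact Real.one_le_exp hc0
  have hm1 : (1 : ℝ) ≤ m := by exact_mod_cast hm
  have hup := (besselI_div_besselI_zero_mem_Icc' m hx).2
  set E := (m : ℝ) * (m - 1) / (2 * (x + m)) with hE
  have hVE : c * ((m : ℝ) - 1) ≤ (V : ℝ) * E := by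
    have hV0 : (2 : ℝ) ≤ V := by exact_mod_cast hV2
    rcases le_or_gt (m : ℝ) x with hmx | hmx
    · -- `m ≤ x`: `E ≥ m(m−1)/(4x)`, `V E ≥ c₁ m(m−1)/4 ≥ (c₁/4)(m−1)`
      have hmm : 0 ≤ (m : ℝ) * (m - 1) := mul_nonneg (by positivity) (by linarith)
      have hA : 0 ≤ (m : ℝ) * (m - 1) / (4 * x) := div_nonneg hmm (by positivity)
      have hE1 : (m : ℝ) * (m - 1) / (4 * x) ≤ E := by
        rw [hE]; exact div_le_div_of_nonneg_left hmm (by positivity) (by linarith)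
      have step1 : c * ((m : ℝ) - 1) ≤ c₁ / 4 * ((m : ℝ) - 1) :=
        mul_le_mul_of_nonneg_right (min_le_left _ _) (by linarith)
      have step2 : c₁ / 4 * ((m : ℝ) - 1) ≤ c₁ / 4 * ((m : ℝ) * (m - 1)) :=
        mul_le_mul_of_nonneg_left (by nlinarith) (by positivity)
      have step3 : c₁ / 4 * ((m : ℝ) * (m - 1)) = (c₁ * x) * ((m : ℝ) * (m - 1) / (4 * x)) := by
        field_simp
      have step4 : (c₁ * x) * ((m : ℝ) * (m - 1) / (4 * x)) ≤ (V : ℝ) * ((m : ℝ) * (m - 1) / (4 * x)) :=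
        mul_le_mul_of_nonneg_right hV hA
      have step5 : (V : ℝ) * ((m : ℝ) * (m - 1) / (4 * x)) ≤ (V : ℝ) * E :=
        mul_le_mul_of_nonneg_left hE1 (by positivity)
      linarith [step3]
    · -- `m > x`: `E ≥ (m−1)/4`, `V E ≥ (m−1)/2`
      have hE1 : ((m : ℝ) - 1) / 4 ≤ E := by
        rw [hE, div_le_div_iff₀ (by norm_num) (by positivity)]
        nlinarith
      calc c * ((m : ℝ) - 1) ≤ 1 / 2 * ((m : ℝ) - 1) := mul_le_mul_of_nonneg_right (min_le_right _ _) (by linarith)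
        _ ≤ 2 * (((m : ℝ) - 1) / 4) := by linarith
        _ ≤ (V : ℝ) * (((m : ℝ) - 1) / 4) := mul_le_mul_of_nonneg_right hV0 (by linarith)
        _ ≤ (V : ℝ) * E := mul_le_mul_of_nonneg_left hE1 (by positivity)
  calc (besselI m x / besselI 0 x) ^ V ≤ Real.exp (-E) ^ V := by
        refine pow_le_pow_left₀ hr0 ?_ V
        simpa [hE, neg_div] using hup
    _ = Real.exp (-((V : ℝ) * E)) := by rw [← Real.exp_nat_mul]; congr 1; ring
    _ ≤ Real.exp (-(c * ((m : ℝ) - 1))) := Real.exp_le_exp.2 (by linarith)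
    _ = Real.exp c * Real.exp (-(c * m)) := by rw [← Real.exp_add]; ring_nf

/-- **Geometric domination of the `SU(2)` terms**: for `x > 0`, `c₁ > 0`, `c₁ x ≤ V ≤ c₂ x` and every
`n` (`2 ≤ V`), `(I_{n+1}(x)/I₁(x))^V ≤ e^{c₂} e^{−c n}` with `c = min(c₁/4, ½)` (`I₁/I₀ ≥ e^{−1/x}`
and `I_{n+1}/I₀ ≤ e^{−n(n+1)/(2(x+n+1))}`). -/
theorem besselI_ratio_one_pow_le {x c₁ c₂ : ℝ} (hx : 0 < x) (hc₁ : 0 < c₁) {V : ℕ} (hV : c₁ * x ≤ V)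
    (hV' : (V : ℝ) ≤ c₂ * x) (hV2 : 2 ≤ V) (n : ℕ) :
    (besselI (n + 1) x / besselI 1 x) ^ V ≤
      Real.exp c₂ * Real.exp (-(min (c₁ / 4) (1 / 2) * n)) := by
  set c := min (c₁ / 4) (1 / 2) with hc
  have hc0 : 0 ≤ c := le_min (by positivity) (by norm_num)
  have hI0 : 0 < besselI 0 x := besselI_pos 0 hx
  have hI1 : 0 < besselI 1 x := besselI_pos 1 hx
  have hr0 : 0 ≤ besselI (n + 1) x / besselI 1 x := div_nonneg (besselI_pos (n + 1) hx).le hI1.le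
  have hV0 : 0 ≤ (V : ℝ) := by positivity
  -- the ratio bound `I_{n+1}/I₁ ≤ e^{1/x} e^{−E}`
  have hlo := (besselI_div_besselI_zero_mem_Icc' 1 hx).1
  have hup := (besselI_div_besselI_zero_mem_Icc' (n + 1) hx).2
  set E := ((n : ℝ) + 1) * n / (2 * (x + (n + 1))) with hE
  have hE0 : 0 ≤ E := by positivity
  have hlo' : Real.exp (-(1 / x)) ≤ besselI 1 x / besselI 0 x := by
    calc Real.exp (-(1 / x)) = Real.exp (-(((1 : ℕ) : ℝ) * (((1 : ℕ) : ℝ) + 1) / (2 * x))) := by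
          congr 1; push_cast; field_simp; ring
      _ ≤ _ := hlo
  have hup' : besselI (n + 1) x / besselI 0 x ≤ Real.exp (-E) := by
    calc besselI (n + 1) x / besselI 0 x ≤ _ := hup
      _ = Real.exp (-E) := by congr 1; rw [hE]; push_cast; ring
  have hratio : besselI (n + 1) x / besselI 1 x ≤ Real.exp (1 / x) * Real.exp (-E) := by
    have e : besselI (n + 1) x / besselI 1 x =
        (besselI (n + 1) x / besselI 0 x) / (besselI 1 x / besselI 0 x) := by
      field_simp
    rw [e, div_le_iff₀ (div_pos hI1 hI0)]
    calc besselI (n + 1) x / besselI 0 x ≤ Real.exp (-E) := hup'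
      _ = Real.exp (1 / x) * Real.exp (-E) * Real.exp (-(1 / x)) := by
          rw [mul_comm (Real.exp (1 / x)), mul_assoc, ← Real.exp_add, add_neg_cancel, Real.exp_zero,
            mul_one]
      _ ≤ Real.exp (1 / x) * Real.exp (-E) * (besselI 1 x / besselI 0 x) :=
          mul_le_mul_of_nonneg_left hlo' (by positivity)
  -- `V E ≥ c n`
  have hVE : c * n ≤ (V : ℝ) * E := by
    have hn0 : (0 : ℝ) ≤ n := by positivity
    have hnn' : 0 ≤ ((n : ℝ) + 1) * n := by positivity
    rcases le_or_gt ((n : ℝ) + 1) x with hnx | hnx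
    · have hA : 0 ≤ ((n : ℝ) + 1) * n / (4 * x) := by positivity
      have hE1 : ((n : ℝ) + 1) * n / (4 * x) ≤ E := by
        rw [hE]; exact div_le_div_of_nonneg_left hnn' (by positivity) (by linarith)
      have step1 : c * n ≤ c₁ / 4 * n := mul_le_mul_of_nonneg_right (min_le_left _ _) hn0
      have step2 : c₁ / 4 * (n : ℝ) ≤ c₁ / 4 * (((n : ℝ) + 1) * n) :=
        mul_le_mul_of_nonneg_left (by nlinarith) (by positivity)
      have step3 : c₁ / 4 * (((n : ℝ) + 1) * n) = (c₁ * x) * (((n : ℝ) + 1) * n / (4 * x)) := by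
        field_simp
      have step4 : (c₁ * x) * (((n : ℝ) + 1) * n / (4 * x)) ≤ (V : ℝ) * (((n : ℝ) + 1) * n / (4 * x)) :=
        mul_le_mul_of_nonneg_right hV hA
      have step5 : (V : ℝ) * (((n : ℝ) + 1) * n / (4 * x)) ≤ (V : ℝ) * E :=
        mul_le_mul_of_nonneg_left hE1 hV0
      linarith [step3]
    · have hE1 : (n : ℝ) / 4 ≤ E := by
        rw [hE, div_le_div_iff₀ (by norm_num) (by positivity)]
        nlinarith
      have hV2' : (2 : ℝ) ≤ V := by exact_mod_cast hV2
      calc c * n ≤ 1 / 2 * n := mul_le_mul_of_nonneg_right (min_le_right _ _) hn0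
        _ = 2 * ((n : ℝ) / 4) := by ring
        _ ≤ (V : ℝ) * ((n : ℝ) / 4) := mul_le_mul_of_nonneg_right hV2' (by positivity)
        _ ≤ (V : ℝ) * E := mul_le_mul_of_nonneg_left hE1 hV0
  calc (besselI (n + 1) x / besselI 1 x) ^ V ≤ (Real.exp (1 / x) * Real.exp (-E)) ^ V :=
        pow_le_pow_left₀ hr0 hratio V
    _ = Real.exp ((V : ℝ) * (1 / x)) * Real.exp (-((V : ℝ) * E)) := by
        rw [mul_pow, ← Real.exp_nat_mul, ← Real.exp_nat_mul]; congr 2; ring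
    _ ≤ Real.exp c₂ * Real.exp (-(c * n)) := by
        refine mul_le_mul (Real.exp_le_exp.2 ?_) (Real.exp_le_exp.2 (by linarith)) (by positivity)
          (by positivity)
        calc (V : ℝ) * (1 / x) = V / x := by ring
          _ ≤ c₂ := by rw [div_le_iff₀ hx]; exact hV'

end Summit.Ventures.LatticeQCDFlow.Scoring
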